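import Summits.BirchSwinnertonDyer.BirchSwinnertonDyer.Theorems.ErratumRoadFiveIMCDivOneSidedNoFiniteSubmoduleFree
import HarnessLib

set_option linter.dupNamespace false -- `Summit.BirchSwinnertonDyer.BirchSwinnertonDyer.Theorems.…` (summit = sub)
set_option autoImplicit false

/-!
# Crux (E) `EisensteinDivisibilityCMInertBad` (stmt-BirchSwinnertonDyer-20239), line `birth`,
# stub `stub_E3`: prime avoidance in `Λ_{R₀} = R₀⟦T⟧`

Route `BiquadraticEisensteinDescent` (cell `pub/bsd-wall`, lead-prover seat `bsd-wall-bed-p1`). The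
registered birth skeleton (planner seat `bsd-wall-cm`, sha `ae7fd998…`) composes the crux (E) from
three stubs; this file proves the algebraic one VERBATIM:

* `stub_E3` — for every ideal `I ⊆ R₀⟦T⟧`, every `L ∈ R₀⟦T⟧` with `p ∤ L` and every `m`, if
  `p^m · I ⊆ (L)` then `I ⊆ (L)`.

Proof: `R₀ = unrIntegers p = 𝒪(\widehat{ℚ_p^{ur}}) ⊂ ℂ_p` is a discrete valuation ring with
uniformiser `p` (tree theorems `X2.HidaLimitAlgebra.isDiscreteValuationRing_unrIntegers`,
`irreducible_natCast_p`), so `p` is prime in `R₀` (tree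
`X11b.CongruenceDescent.prime_natCast_p_unrIntegers`, reused), hence the constant series `C p` is prime in `R₀⟦T⟧`
(tree `Literature.NumberTheory.EllipticCurves.prime_C_of_prime`: `R₀⟦T⟧/(p) ≅ 𝔽̄_p⟦T⟧` is a domain);
from `(C p)^m · x = y · L` and `C p ∤ L` we get `(C p)^m ∣ y` (`Prime.pow_dvd_of_dvd_mul_right`) and
cancel `(C p)^m` in the domain `R₀⟦T⟧`.

THEOREMS ONLY (no definition, no named fact, no `sorry`); imports no `Theses` module; nothing about
any curve is asserted. Supports, does not close, stmt-BirchSwinnertonDyer-20239.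

References: [SerreLocalFields1979] Ch. II §5 (`𝒪(\widehat{K^{ur}})`); [Washington1997] §7.1;
[Castella2018] §3 p. 9 (`R₀`, `Λ_{R₀}`).
-/

noncomputable section

open scoped Classical

open PowerSeries Literature.NumberTheory.EllipticCurves
  Summit.BirchSwinnertonDyer.Rank1Residual.X11b

namespace Summit.BirchSwinnertonDyer.BirchSwinnertonDyer.Theorems.BiquadraticEisensteinDescentEisensteinDivisibilityCMInertBadStubE3

variable {p : ℕ} [hp : Fact p.Prime]

/-- **The constant series `p` is a prime element of `Λ_{R₀} = R₀⟦T⟧`** (`R₀⟦T⟧/(p) ≅ 𝔽̄_p⟦T⟧` is a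
domain). [folklore] -/
theorem prime_C_natCast_p : Prime (C ((p : ℕ) : unrIntegers p) : UnrSeries p) :=
  prime_C_of_prime CongruenceDescent.prime_natCast_p_unrIntegers

/-- **Prime avoidance by `p` in `R₀⟦T⟧`, one element**: if `p ∤ L` and `p^m · x ∈ (L)` then
`x ∈ (L)`. [folklore] -/
theorem mem_span_of_C_pow_mul_mem_span {L x : UnrSeries p} {m : ℕ}
    (hL : ¬ ((C ((p : ℕ) : unrIntegers p) : UnrSeries p) ∣ L))
    (hx : (C ((p : ℕ) : unrIntegers p) : UnrSeries p) ^ m * x ∈ Ideal.span {L}) :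
    x ∈ Ideal.span {L} := by
  obtain ⟨y, hy⟩ := Ideal.mem_span_singleton'.mp hx
  -- `hy : y * L = C p ^ m * x`
  have hdvd : (C ((p : ℕ) : unrIntegers p) : UnrSeries p) ^ m ∣ y * L := ⟨x, hy⟩
  obtain ⟨z, rfl⟩ := prime_C_natCast_p.pow_dvd_of_dvd_mul_right m hL hdvd
  have hne : (C ((p : ℕ) : unrIntegers p) : UnrSeries p) ^ m ≠ 0 :=
    pow_ne_zero _ prime_C_natCast_p.ne_zero
  have hxz : x = z * L := by
    apply mul_left_cancel₀ hne
    rw [← hy, mul_assoc]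
  rw [hxz]
  exact Ideal.mul_mem_left _ z (Ideal.mem_span_singleton_self L)

/-- **STUB E3** of the birth skeleton of crux (E) `EisensteinDivisibilityCMInertBad`
(stmt-BirchSwinnertonDyer-20239), VERBATIM: prime avoidance in `R₀⟦T⟧` — `R₀ = 𝒪(\widehat{ℚ_p^{ur}})
= W(𝔽̄_p)` is a complete DVR with uniformiser `p`, so `p` is a prime element of `R₀⟦T⟧`; hence
`p ∤ L` and `p^m · I ⊆ (L)` force `I ⊆ (L)`. [folklore] -/
theorem stub_E3 :
  ∀ (p : ℕ) [Fact p.Prime] (I : Ideal (UnrSeries p)) (L : UnrSeries p) (m : ℕ),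
    ¬ ((PowerSeries.C ((p : ℕ) : unrIntegers p) : UnrSeries p) ∣ L) →
    (∀ x ∈ I, (PowerSeries.C ((p : ℕ) : unrIntegers p) : UnrSeries p) ^ m * x ∈ Ideal.span {L}) →
      I ≤ Ideal.span {L} := by
  intro p _ I L m hL hI x hx
  exact mem_span_of_C_pow_mul_mem_span hL (hI x hx)

end Summit.BirchSwinnertonDyer.BirchSwinnertonDyer.Theorems.BiquadraticEisensteinDescentEisensteinDivisibilityCMInertBadStubE3

end
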